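import Literature.NumberTheory.Automorphic.Liu2021.Def411WeilCarriersDoublingDetTwist
import HarnessLib

/-!
# The splitting ↦ character dictionary at the hermitian line, modulo «central characters factor through `det`»

Topic `NumberTheory/Automorphic/Liu2021`; namespace `Literature.NumberTheory.Automorphic.Liu2021.Def411WeilCarriersDoubling`.
KERNEL only: one displayed predicate WITH PARAMETERS (`CentralCharFactorsThroughDet`, a hypothesis shape — NOT asserted, NOT a named
fact) and one proved theorem; no `sorry`.

[GelbartRogawski1991, §3.1 Remark p. 457 L4–13] (verbatim): "A choice of splitting `s` as in the proposition will be called *compatible*.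
It is determined by the function `b(HK)` defined above. Thus, a choice of `s` is equivalent to a choice of Hecke character of `E` whose
restriction to `F` is `ω_{E/F}`, once `ψ` is fixed. … If `s*` is any other compatible splitting, then `s* = s ⊗ ν′`, where `ν′` is an
automorphic character of `E¹`, regarded as a character of `G` with values in the central subgroup `ℂ*` of `Mp_𝐀(W)`".

The tree has the dictionary `χ ↦ ι_χ := chiSplittingLine χ` (doubling, `Def411WeilCarriersDoubling`), its choice-freeness
(`Def411WeilCarriersDoublingUnique`), its det-twist law `ι_{χ·α̃} = ι_χ ⊗ (α ∘ det)` (`Def411WeilCarriersDoublingDetTwist`), and the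
torsor half of the Remark (`SplittingDatum.IsCompatible.exists_central_twist` ∕ `adelicMpCont.exists_eq_twist_continuous`: two continuous
compatible splittings differ by a continuous character of `G₁(𝔸)` trivial on `G₁(L⁺)`).  The ONE sentence of the Remark that is not a tree
theorem is «regarded as a character of `G`»: that such a character FACTORS THROUGH `det : G₁(𝔸) → U(1)(𝔸)` (for `G = U(3)`: the derived
group `SU(3)` is perfect at every place).  This file DISPLAYS it as the predicate `CentralCharFactorsThroughDet` and proves, modulo it:

* **`exists_eq_chiSplittingLine_of_isCompatible`** — every CONTINUOUS compatible splitting `s` of the line datum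
  `splittingDatum L⁺ L c̄ N 1 e (diag dV) J_W …` IS a dictionary splitting: `s = ι_{χ₀ · α̃}` for a continuous unitary automorphic
  character `α` of `U(1)(𝔸_{L⁺})` (`α̃ = DoubledWeilDetTwist.ratioHecke α`), for any base point `χ₀` of the dictionary.

References: S. Gelbart, J. Rogawski, Invent. Math. 105 (1991), §3.1 Prop. 3.1.1 p. 455, Remark p. 457 L4–13 [GelbartRogawski1991];
M. Harris, S. Kudla, W. J. Sweet, J. AMS 9 (1996), §1 (1.14)–(1.15), Cor. A.3 [HarrisKudlaSweet1996]; Y. Liu, Camb. J. Math. 9 (2021),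
App. D §D.1 Step 2 [Liu2021].
Provenance: pub-hodgecm2 cell (COR-CM, Hodge ladder stage 2), seat pin-3 (Δ2/X3 co-owner): X3-Char residual — with this file X3-Char at the
continuous index lines of the pinned dictionary is a tree theorem MODULO `CentralCharFactorsThroughDet` (item (A)) and the archimedean
type reading (item (E)).  HC_CM is NOT proved here or anywhere in the tree.
-/

set_option autoImplicit false

noncomputable section

open scoped Classical
open scoped Matrix Kronecker TensorProduct
open NumberField IsDedekindDomain
open Literature.RepresentationTheory.HeisenbergGroup
open Literature.NumberTheory.Weil1964
open Literature.RepresentationTheory.HarrisKudlaSweet1996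
open Literature.NumberTheory.Automorphic
open Literature.NumberTheory.GaloisRepresentations

namespace Literature.NumberTheory.Automorphic.Liu2021.Def411WeilCarriersDoubling

open Literature.NumberTheory.GelbartRogawski1991 Literature.NumberTheory.GelbartRogawski1991.UnitaryDualPair
open Literature.NumberTheory.GelbartRogawski1991.GRConstruction
open Literature.NumberTheory.GelbartRogawski1991.GRConstruction.DoubledWeilDetTwist

/-! ## §1 The displayed predicate: central characters of `G₁(𝔸)` trivial on `G₁(F)` factor through `det` -/

section Predicate

variable (F E : Type) [Field F] [NumberField F] [Field E] [NumberField E] [Algebra F E]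
variable (c : E ≃ₐ[F] E) (N M : ℕ) {n : ℕ} (e : Fin N × Fin M ≃ Fin n)
variable (JV : Matrix (Fin N) (Fin N) E) (JW : Matrix (Fin M) (Fin M) E)

/-- **«regarded as a character of `G`» [GelbartRogawski1991, §3.1 Remark p. 457 L9–13], as a DISPLAYED PREDICATE** on the pair form
`(J_V, J_W)`: every continuous character `η : G₁(𝔸_F) = U(J_V ⊗ J_W)(𝔸_F) →* ℂˣ` trivial on the rational points `G₁(F)` is
`α ∘ det` for a continuous UNITARY AUTOMORPHIC character `α` of `U(1)(𝔸_F)` (automorphic = trivial on the principal norm-one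
ideles `U(1)(F)`).  Printed for `G = U(3)`; true whenever `SU(J_V ⊗ J_W)(F_v)` is perfect at every place `v` and `det` is onto
`U(1)`.  HYPOTHESIS SHAPE [GelbartRogawski1991, §3.1 Remark p. 457 L9–13]: NOT proved, NOT asserted, NOT a named fact — a consumer
takes `(hA : CentralCharFactorsThroughDet …)` as an explicit hypothesis, and no theorem of this file concludes it.
[cite: GelbartRogawski1991, §3.1 Remark p. 457 L9–13] -/
def CentralCharFactorsThroughDet (hd : (Matrix.reindex e e (JV ⊗ₖ JW)).det ≠ 0) : Prop :=
  ∀ η : UnitaryGroup.adelicPair F E c N M JV JW →* ℂˣ, Continuous η →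
    (∀ γ ∈ (UnitaryGroup.rationalPairToAdelic F E c N M JV JW).range, η γ = 1) →
      ∃ α : UnitaryGroup.adelicOne F E c →* ℂˣ, Continuous α ∧ (∀ u, ‖((α u : ℂˣ) : ℂ)‖ = 1) ∧
        (∀ u : UnitaryGroup.adelicOne F E c, (u : (AdeleRing (𝓞 E) E)ˣ) ∈ principalIdeles E → α u = 1) ∧
          η = α.comp (pairDet F E c N M e JV JW hd)

end Predicate

/-! ## §2 The dictionary at the hermitian line, modulo the predicate -/

variable (L : Type) [Field L] [NumberField L] [IsCMField L]

variable {N' n' : ℕ} (e₁ : Fin N' × Fin 1 ≃ Fin n')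
  (dV₁ : Fin N' → L) (hdV₁ : ∀ i, IsCMField.complexConj L (dV₁ i) = dV₁ i) (hdV₁0 : ∀ i, dV₁ i ≠ 0)

include hdV₁0 in
set_option maxHeartbeats 2000000 in
-- (the statement carries the `splittingDatum` telescope of `isCompatible_chiSplittingLine`; same budget as that theorem)
/-- **Every continuous compatible splitting of the line datum is a dictionary splitting** (modulo `CentralCharFactorsThroughDet`).
For the LINE datum `splittingDatum L⁺ L c̄ N 1 e (diag dV) J_W …` of `isCompatible_chiSplittingLine` (any proofs `hW`, `hWd`, `hJW`),
a base point `χ₀` of the dictionary (unitary, `χ₀|_{𝕀_{L⁺}} = ε`) and a CONTINUOUS `s` with `IsCompatible s`: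
`s = ι_{χ₀} ⊗ η` for a continuous `η` (`adelicMpCont.exists_eq_twist_continuous`); `η` is trivial on `G₁(L⁺)` because `s` and `ι_{χ₀}`
both carry `G₁(L⁺)` into `r_F(Sp_F)` over the same `ι` (`IsCompatible.apply_eq_ratSplit`, `ofScalar_injective`); by the predicate
`η = α ∘ det`; and `ι_{χ₀} ⊗ (α ∘ det) = ι_{χ₀·α̃}` (`chiSplittingLine_mul_ratioHecke`).  So «a choice of `s` is equivalent to a choice
of Hecke character»: `s = ι_χ`, `χ = χ₀ · α̃`. [cite: GelbartRogawski1991, §3.1 Remark p. 457 L4–13] [cite: Liu2021, App. D §D.1 Step 2 (l. 5219)] [cite: HarrisKudlaSweet1996, §1 (1.14)–(1.15), Cor. A.3 p. 998] -/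
theorem exists_eq_chiSplittingLine_of_isCompatible (TW : Matrix (Fin 1) (Fin 1) (Fp L)) (hW : TW.IsSymm) (hWd : IsUnit TW.det)
    (JW : Matrix (Fin 1) (Fin 1) L) (hJW : JW = TW.map (algebraMap (Fp L) L))
    (hA : CentralCharFactorsThroughDet (Fp L) L (IsCMField.complexConj L) N' 1 e₁ (Matrix.diagonal dV₁) JW
      (det_reindex_kronecker_diagonal_line_ne_zero L e₁ dV₁ hdV₁0 TW hWd JW hJW))
    (χ₀ : HeckeCharacter L) (hχ₀u : χ₀.IsUnitary) (hχ₀s : IsSplittingChar L 1 χ₀)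
    {s : UnitaryGroup.adelicPair (Fp L) L (IsCMField.complexConj L) N' 1 (Matrix.diagonal dV₁) JW →*
      adelicMpCont (Fp L) (Fin n') (adelicGram (Fp L) e₁ (realDiagonal L dV₁ hdV₁) TW)}
    (hsc : Continuous s)
    (hs : (splittingDatum (Fp L) L (IsCMField.complexConj L) N' 1 e₁ (Matrix.diagonal dV₁) JW
        (complexConj_imagUnit L) (imagUnit_ne_zero L) (imagUnit_mul_self L) (realDiagonal_isSymm L dV₁ hdV₁) hW
        (isUnit_det_realDiagonal L dV₁ hdV₁ hdV₁0) hWd (realDiagonal_map L dV₁ hdV₁).symm hJW).IsCompatible s) :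
    ∃ (α : UnitaryGroup.adelicOne (Fp L) L (IsCMField.complexConj L) →* ℂˣ) (hα : Continuous α)
      (hαrat : ∀ u : UnitaryGroup.adelicOne (Fp L) L (IsCMField.complexConj L), (u : ideleGroup L) ∈ principalIdeles L → α u = 1)
      (hαu : ∀ u, ‖((α u : ℂˣ) : ℂ)‖ = 1),
      s = chiSplittingLine L e₁ dV₁ hdV₁ hdV₁0 (χ₀ * ratioHecke L α hα hαrat) (isUnitary_mul_ratioHecke L hχ₀u hα hαrat hαu)
            ((isSplittingChar_mul_ratioHecke_iff L 1 χ₀ hα hαrat).2 hχ₀s) TW hWd JW hJW := by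
  have hι := isCompatible_chiSplittingLine L e₁ dV₁ hdV₁ hdV₁0 χ₀ hχ₀u hχ₀s TW hW hWd JW hJW
  have hιc := continuous_chiSplittingLine L e₁ dV₁ hdV₁ hdV₁0 χ₀ hχ₀u hχ₀s TW hWd JW hJW
  obtain ⟨η, hηc, hη⟩ := adelicMpCont.exists_eq_twist_continuous
    (chiSplittingLine L e₁ dV₁ hdV₁ hdV₁0 χ₀ hχ₀u hχ₀s TW hWd JW hJW) s
    (isUnit_adelicGram (Fp L) e₁ (isUnit_det_realDiagonal L dV₁ hdV₁ hdV₁0) hWd) (fun g => (hι.1 g).trans (hs.1 g).symm) hιc hsc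
  -- `η` is trivial on the rational points: `s γ = r_F(ι γ) = ι_{χ₀} γ` there
  have hηrat : ∀ γ ∈ (UnitaryGroup.rationalPairToAdelic (Fp L) L (IsCMField.complexConj L) N' 1 (Matrix.diagonal dV₁) JW).range,
      η γ = 1 := by
    intro γ hγ
    have e1 : s γ = chiSplittingLine L e₁ dV₁ hdV₁ hdV₁0 χ₀ hχ₀u hχ₀s TW hWd JW hJW γ :=
      (hs.apply_eq_ratSplit hγ).trans (hι.apply_eq_ratSplit hγ).symm
    have e2 : adelicMpCont.ofScalar (Fp L) (Fin n') (adelicGram (Fp L) e₁ (realDiagonal L dV₁ hdV₁) TW) (η γ) *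
        chiSplittingLine L e₁ dV₁ hdV₁ hdV₁0 χ₀ hχ₀u hχ₀s TW hWd JW hJW γ =
      1 * chiSplittingLine L e₁ dV₁ hdV₁ hdV₁0 χ₀ hχ₀u hχ₀s TW hWd JW hJW γ :=
      (adelicMpCont.twist_apply _ η γ).symm.trans (((DFunLike.congr_fun hη γ).symm.trans e1).trans (one_mul _).symm)
    exact adelicMpCont.ofScalar_injective ((mul_right_cancel e2).trans (map_one _).symm)
  obtain ⟨α, hα, hαu, hαrat, hηα⟩ := hA η hηc hηrat
  refine ⟨α, hα, hαrat, hαu, hη.trans ?_⟩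
  rw [hηα]
  exact (chiSplittingLine_mul_ratioHecke L e₁ dV₁ hdV₁ hdV₁0 χ₀ hχ₀u hχ₀s hα hαrat hαu TW hWd JW hJW).symm

end Literature.NumberTheory.Automorphic.Liu2021.Def411WeilCarriersDoubling

end
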